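import Literature.MathematicalPhysics.QuantumFieldTheory.Balaban1983to89.Node00.Record12Carriers

/-!
# NODE 00 (YM-PLAN Track A) — THE CARRIER-PINNED STAGE-12 RECORDS, I: `IsRecordOfRecord₁₂CB10YZW → IsRecordOfRecord₁₂C` (SAME datum, SAME world; [B10] ∕ [B9] ∕ [B11] ∕
# [IV] groups pinned) and `IsRecordOfRecord₁₂CB10YZWB8` (+ [B8], `b8` surviving; SAME-DATUM companion in `₁₂CB10YZW`) with the N05 ∕ N06 ∕ N07 ∕ N08 ∕ N12 faces BY NAME —
# g31's `Record11Carriers` §2 + `Record11CarriersB8` §3 restated at def-T's `Record12` (`12 ← 11` verbatim; sequel of `Node00/Record12Carriers`)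

NODE 00 RECORD MODULE (seat `pub-ymgap-node00-def` g32, 2026-08-26; director-ym R134 (c) t4; lead R457 repair lane ₁₂).  APPEND-ONLY: a NEW importing module; everything it
reads is CONSUMED BY NAME (`Record12`'s `IsRecordOfRecord₁₂C`, `exists_world_isRecordOfRecord₁₂C`, `atWorld_of_isRecordOfRecord₁₂C`, `datumOfRecord₁₂`; `Record12Carriers`'
pins, views and leaves).  Read rule for consumers (ref-C's (B8-1)–(B8-5), unchanged at ₁₂): b8-reading sentences port through `nodes_iff_bundles_of_…` ∕ `leaf…_iff_of_…` with
`B8LeafOfRecord` DISPLAYED — never an `atWorld` transfer from `₁₂CB10YZW`; the leaf is never a field.  [Balaban1988Convergent] = Commun. Math. Phys. **119** (1988) 243–285;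
[Balaban1989LargeFieldII] = Commun. Math. Phys. **122** (1989) 355–392.

WHAT IS DEFINED ∕ PROVED (kernel bookkeeping, 0 sorry).  §2 **`IsRecordOfRecord₁₂CB10YZW D w`** := `IsRecordOfRecord₁₂C` VERBATIM with the upstream block at the four-pin view;
`exists_world_…` (inhabitation = ₁₂C's); **`isRecordOfRecord₁₂C_of_isRecordOfRecord₁₂CB10YZW`** (SAME D, SAME w: quadruply pinned witness, provisos with EXPLICIT proofs,
admissibility by the `iff` chain — kernel lesson 8), `atWorld_of_…`, `…_rebind_of_isRecordOfRecord₁₂C`, `leaves_iff_of_…`, `b10_main_iff_of_…` (N08 exactly),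
`b11_main_iff_bundles_of_…` (N07 at the bundles), `b9_b11_b15_main_of_…_of_slots` (N06 ∕ N07 ∕ N12 slots form).  §3 **`IsRecordOfRecord₁₂CB10YZWB8 D w`** (S-binding at the
five-pin view, residual [B8] layer ∃-quantified), `exists_world_…`, **`companion_of_…`** (same D∕C∕γ∕L companion in `₁₂CB10YZW`; leaves agree off `b8`; companion b8 (typed) ⇒
record b8 (surviving)), `leaves_iff_of_…`, `b4_b5_b6_b7_of_…`, `b8_b11_b10_main_iff_of_…`, `nodes_iff_bundles_of_…`, `b8_main_of_…_of_slots`, `…_rebind_of_isRecordOfRecord₁₂C`.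
Residual layers EXPLICIT, quantified with the record's parameters, no law assumed — the ∀-forms stay junk-able as at ₁₁ (SAID).  HONEST FRAMING: definitions + kernel
bookkeeping; NO estimate; nothing of Bałaban's asserted; no node discharged; counts unmoved (5∕28); one finite T⁴ programme at fixed ε — NOT continuum ∕ ℝ⁴ ∕ infinite volume ∕
OS ∕ mass gap ∕ Clay.  No `sorry`, no `axiom`, no `opaque`, no `instance`, no `notation`. -/

noncomputable section

namespace Literature.MathematicalPhysics.QuantumFieldTheory.Balaban1983to89.Node00

open T4Continuum AveragingRT T4FiniteEpsInhabited FlowStep FlowStepRuns DagBinding T4DatumAssembly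
open B8LeafKnitRS (B8LeafRS)
open scoped Matrix.Norms.L2Operator

/-! ## §2. `IsRecordOfRecord₁₂CB10YZW` — the four same-world pins at Stage 12 -/

section Record12

variable (F : T4Family) (N : ℕ) [NeZero N]

/-- **«(D, w) is the record, Stage 12, [B10] ∕ [B9] ∕ [B11] ∕ [IV] groups pinned»**: def-T's `IsRecordOfRecord₁₂C` VERBATIM except that the upstream block is the C-binding at
the four-pin view, for SOME floor, operator layer, [B11] layer and [IV] layer (residual data quantified with the record's parameters; no law assumed).
[cite: Balaban1985UV3, Thm 1 p.257 + Thm 2 p.272; Balaban1985BackgroundPropagators, Thms 3.1–3.15 pp.397–432; Balaban1985Variational, Thm 1 p.279; Balaban1989LargeFieldI, (0.2)–(0.6) p.176; Balaban1988Convergent, (2.18)–(2.42) pp.257–262; Balaban1989LargeFieldII, Thm 1 + (0.1) pp.355–356 (objects of record)] -/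
def IsRecordOfRecord₁₂CB10YZW (D : FiniteEpsData F (SU N)) (w : WorldP) : Prop :=
  ∃ (θ : Stage12Params F N) (h : θ.Provisos₁₂ F N) (Mstar : ℕ) (ops : OpsY N θ.toStage3Params Mstar) (ζ : ResidZ F N) (lamW : ResidW F N),
    θ.Admissible F N ∧ D = datumOfRecord₁₂ F N θ h ∧ w.C = D.C ∧ (0 < w.γ ∧ w.γ ≤ θ.γ) ∧ w.L = (θ.L : ℝ) ∧
      ∀ P : B12.RunParams, w.up P = upOfRecord₅C F N (θ.view₁₂B10YZW F N Mstar ops ζ lamW) P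

/-- **Inhabitation is Stage 12's EXACTLY** (any four residual layers). [cite: Balaban1989LargeFieldII, Thm 1 + (0.1) pp.355–356 (bookkeeping)] -/
theorem exists_world_isRecordOfRecord₁₂CB10YZW (θ : Stage12Params F N) (h : θ.Provisos₁₂ F N) (hθ : θ.Admissible F N) (Mstar : ℕ) (ops : OpsY N θ.toStage3Params Mstar)
    (ζ : ResidZ F N) (lamW : ResidW F N) {γw : ℝ} (hγw : 0 < γw ∧ γw ≤ θ.γ) :
    ∃ w : WorldP, IsRecordOfRecord₁₂CB10YZW F N (datumOfRecord₁₂ F N θ h) w ∧ w.γ = γw := by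
  obtain ⟨w₀, -, -⟩ := exists_world_isRecordOfRecord₁₂C F N θ h hθ hγw
  exact ⟨{ w₀ with
      C := (datumOfRecord₁₂ F N θ h).C, γ := γw, L := (θ.L : ℝ), one_lt_L := by exact_mod_cast θ.hL.2,
      up := fun P => upOfRecord₅C F N (θ.view₁₂B10YZW F N Mstar ops ζ lamW) P },
    ⟨θ, h, Mstar, ops, ζ, lamW, hθ, rfl, rfl, hγw, rfl, fun _ => rfl⟩, rfl⟩

variable {F N}
variable {D : FiniteEpsData F (SU N)} {w : WorldP}

/-- **Refinement `IsRecordOfRecord₁₂CB10YZW → IsRecordOfRecord₁₂C`** with THE SAME datum AND world: witness the quadruply pinned parameters (provisos transported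
field by field with EXPLICIT proofs, datum `rfl` ×4, view `view₁₂B10YZW_eq`). [cite: Balaban1989LargeFieldII, Thm 1 + (0.1) pp.355–356 (bookkeeping)] -/
theorem isRecordOfRecord₁₂C_of_isRecordOfRecord₁₂CB10YZW (h : IsRecordOfRecord₁₂CB10YZW F N D w) : IsRecordOfRecord₁₂C F N D w := by
  obtain ⟨θ, hP, Mstar, ops, ζ, lamW, hθ, hD, hC, hγ, hL, hup⟩ := h
  have h₁ : (θ.pinB10 F N).Provisos₁₂ F N := hP.pinB10
  have h₂ : ((θ.pinB10 F N).pinY F N (Y9OfRecord N θ.toStage3Params Mstar ops)).Provisos₁₂ F N := h₁.pinY _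
  have h₃ : (((θ.pinB10 F N).pinY F N (Y9OfRecord N θ.toStage3Params Mstar ops)).pinZ F N (Z11OfRecord F N ζ)).Provisos₁₂ F N := h₂.pinZ _
  have h₄ : ((((θ.pinB10 F N).pinY F N (Y9OfRecord N θ.toStage3Params Mstar ops)).pinZ F N (Z11OfRecord F N ζ)).pinW F N (WOfRecord₁₂ F N θ lamW)).Provisos₁₂ F N :=
    h₃.pinW _
  have hθ' : ((((θ.pinB10 F N).pinY F N (Y9OfRecord N θ.toStage3Params Mstar ops)).pinZ F N (Z11OfRecord F N ζ)).pinW F N (WOfRecord₁₂ F N θ lamW)).Admissible F N :=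
    (Stage12Params.pinW_admissible_iff F N _ _).2 ((Stage12Params.pinZ_admissible_iff F N _ _).2
      ((Stage12Params.pinY_admissible_iff F N _ _).2 ((Stage12Params.pinB10_admissible_iff F N _).2 hθ)))
  refine ⟨_, h₄, hθ', ?_, hC, hγ, hL, fun P => ?_⟩
  · rw [datumOfRecord₁₂_pinW F N _ h₃, datumOfRecord₁₂_pinZ F N _ h₂, datumOfRecord₁₂_pinY F N _ h₁, datumOfRecord₁₂_pinB10 F N θ hP]
    exact hD
  · rw [hup P, Stage12Params.view₁₂B10YZW_eq]

/-- The `atWorld` transfer (def-T's `atWorld_of_isRecordOfRecord₁₂C` by name). [cite: Balaban1989LargeFieldII, Thm 1 p.355 (bookkeeping)] -/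
theorem atWorld_of_isRecordOfRecord₁₂CB10YZW {X : Dag.Leaves → Prop}
    (h₅ : ∀ (D : FiniteEpsData F (SU N)) (w : WorldP), IsRecordOfRecord₅C F N D w → ∀ P : B12.RunParams, X (leavesP w P))
    (h : IsRecordOfRecord₁₂CB10YZW F N D w) (P : B12.RunParams) : X (leavesP w P) :=
  atWorld_of_isRecordOfRecord₁₂C h₅ (isRecordOfRecord₁₂C_of_isRecordOfRecord₁₂CB10YZW h) P

/-- RE-BINDING a `₁₂C` record's world by the four-pin view gives a record of this module with the SAME datum. [cite: Balaban1989LargeFieldII, Thm 1 p.355 (bookkeeping)] -/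
theorem isRecordOfRecord₁₂CB10YZW_rebind_of_isRecordOfRecord₁₂C (h : IsRecordOfRecord₁₂C F N D w) :
    ∃ (θ : Stage12Params F N) (_ : θ.Provisos₁₂ F N), θ.Admissible F N ∧ (∀ P, w.up P = upOfRecord₅C F N (θ.toStage5₁₂ F N) P) ∧
      ∀ (Mstar : ℕ) (ops : OpsY N θ.toStage3Params Mstar) (ζ : ResidZ F N) (lamW : ResidW F N),
        IsRecordOfRecord₁₂CB10YZW F N D { w with up := fun P => upOfRecord₅C F N (θ.view₁₂B10YZW F N Mstar ops ζ lamW) P } := by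
  obtain ⟨θ, hP, hθ, hD, hC, hγ, hL, hup⟩ := h
  exact ⟨θ, hP, hθ, hup, fun Mstar ops ζ lamW => ⟨θ, hP, Mstar, ops, ζ, lamW, hθ, hD, hC, hγ, hL, fun _ => rfl⟩⟩

/-- **THE FOUR PINNED LEAVES AT A RECORD OF THIS MODULE, for ONE parameter package**. [cite: Balaban1989LargeFieldI, Prop. 1 p.194; Balaban1985Variational, Thm 1 p.279; Balaban1985BackgroundPropagators, Thm 3.1 p.397; Balaban1985UV3, Thm 1 p.257] -/
theorem leaves_iff_of_isRecordOfRecord₁₂CB10YZW (h : IsRecordOfRecord₁₂CB10YZW F N D w) :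
    ∃ (θ : Stage12Params F N) (Mstar : ℕ) (ops : OpsY N θ.toStage3Params Mstar) (ζ : ResidZ F N) (lamW : ResidW F N), θ.Admissible F N ∧ w.L = (θ.L : ℝ) ∧
      ∀ P : B12.RunParams,
        ((leavesP w P).rBasicStep ↔ B15Leaf (WOfRecord₁₂ F N θ lamW P)) ∧ ((leavesP w P).b9 ↔ B9LeafX (Y9OfRecord N θ.toStage3Params Mstar ops)) ∧
        ((leavesP w P).b10 ↔ PrintedUV3V N θ.L) ∧ ((leavesP w P).b11 ↔ B11Leaf (Z11OfRecord F N ζ)) := by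
  obtain ⟨θ, -, Mstar, ops, ζ, lamW, hθ, -, -, -, hL, hup⟩ := h
  refine ⟨θ, Mstar, ops, ζ, lamW, hθ, hL, fun P => ?_⟩
  have hl := upOfRecord₅C_view₁₂B10YZW_leaves F N θ Mstar ops ζ lamW P
  refine ⟨?_, ?_, ?_, ?_⟩
  · show (w.up P).rBasicStep ↔ _
    rw [hup P]; exact hl.1
  · show (w.up P).b9 ↔ _
    rw [hup P]; exact hl.2.1
  · show (w.up P).b10 ↔ _
    rw [hup P]; exact hl.2.2.1
  · show (w.up P).b11 ↔ _
    rw [hup P]; exact hl.2.2.2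

/-- **N08 at a record of this module, EXACTLY**. [cite: Balaban1985UV3, Thm 1 p.257 + Thm 2 p.272 (the node's shape `Dag.B10_main`, bookkeeping)] -/
theorem b10_main_iff_of_isRecordOfRecord₁₂CB10YZW (h : IsRecordOfRecord₁₂CB10YZW F N D w) :
    ∃ L : ℕ, (Odd L ∧ 1 < L) ∧ w.L = (L : ℝ) ∧ ∀ P : B12.RunParams,
      (Dag.B10_main (leavesP w P) ↔
        ((leavesP w P).b5 → (leavesP w P).b6 → (leavesP w P).b7 → (leavesP w P).b8 → (leavesP w P).b9 → (leavesP w P).b11 →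
          PrintedUV3V N L)) := by
  obtain ⟨θ, Mstar, ops, ζ, lamW, -, hwL, hl⟩ := leaves_iff_of_isRecordOfRecord₁₂CB10YZW h
  refine ⟨θ.L, θ.hL, hwL, fun P => ?_⟩
  unfold Dag.B10_main
  rw [(hl P).2.2.1]

/-- **N07 AT A RECORD OF THIS MODULE, AT THE BUNDLES OF RECORD** (`b4 b5 b6 b7` theorems of the record). [cite: Balaban1985Variational, Thm 1 p.279, Props 2–9 pp.281–309 (bookkeeping: the node at a record)] -/
theorem b11_main_iff_bundles_of_isRecordOfRecord₁₂CB10YZW (h : IsRecordOfRecord₁₂CB10YZW F N D w) :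
    ∃ (θ : Stage12Params F N) (Mstar : ℕ) (ops : OpsY N θ.toStage3Params Mstar) (ζ : ResidZ F N), θ.Admissible F N ∧ w.L = (θ.L : ℝ) ∧
      ∀ P : B12.RunParams,
        (Dag.B11_main (leavesP w P) ↔
          ((leavesP w P).b8 → B9LeafX (Y9OfRecord N θ.toStage3Params Mstar ops) → B11Leaf (Z11OfRecord F N ζ))) := by
  obtain ⟨θ, Mstar, ops, ζ, lamW, hθ, hL, hl⟩ := leaves_iff_of_isRecordOfRecord₁₂CB10YZW h
  refine ⟨θ, Mstar, ops, ζ, hθ, hL, fun P => ?_⟩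
  have h57 : Dag.B11_main (leavesP w P) ↔ ((leavesP w P).b8 → (leavesP w P).b9 → (leavesP w P).b11) :=
    atWorld_of_isRecordOfRecord₁₂CB10YZW (X := fun ℓ => Dag.B11_main ℓ ↔ (ℓ.b8 → ℓ.b9 → ℓ.b11))
      (fun _ _ h5 P => B11LeafUnpinnedRecord.b11_main_iff_of_isRecordOfRecord₅C h5 P) h P
  rw [h57, (hl P).2.1, (hl P).2.2.2]

/-- **N06 ∕ N07 ∕ N12 «SLOTS» FORM at a record of this module** (hypotheses over the HIDDEN residual layers — honest).
[cite: Balaban1985BackgroundPropagators, Thms 3.1–3.15 pp.397–432; Balaban1985Variational, Thm 1 p.279; Balaban1989LargeFieldI, Prop. 1 p.194, (0.2)–(0.6) p.176 (the nodes' shapes, bookkeeping)] -/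
theorem b9_b11_b15_main_of_isRecordOfRecord₁₂CB10YZW_of_slots (h : IsRecordOfRecord₁₂CB10YZW F N D w)
    (hYZW : ∀ (θ : Stage12Params F N) (hP : θ.Provisos₁₂ F N) (Mstar : ℕ) (ops : OpsY N θ.toStage3Params Mstar) (ζ : ResidZ F N) (lamW : ResidW F N), θ.Admissible F N →
      D = datumOfRecord₁₂ F N θ hP → (∀ P, w.up P = upOfRecord₅C F N (θ.view₁₂B10YZW F N Mstar ops ζ lamW) P) →
        B9LeafX (Y9OfRecord N θ.toStage3Params Mstar ops) ∧ B11Leaf (Z11OfRecord F N ζ) ∧ ∀ P, B15Leaf (WOfRecord₁₂ F N θ lamW P))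
    (P : B12.RunParams) : Dag.B9_main (leavesP w P) ∧ Dag.B11_main (leavesP w P) ∧ Dag.B15_main (leavesP w P) := by
  obtain ⟨θ, hP, Mstar, ops, ζ, lamW, hθ, hD, -, -, -, hup⟩ := h
  have hl := upOfRecord₅C_view₁₂B10YZW_leaves F N θ Mstar ops ζ lamW P
  have hyzw := hYZW θ hP Mstar ops ζ lamW hθ hD hup
  refine ⟨fun _ _ _ _ => ?_, fun _ _ _ _ _ => ?_, fun _ _ _ _ _ => ?_⟩
  · show (w.up P).b9
    rw [hup P]; exact hl.2.1.2 hyzw.1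
  · show (w.up P).b11
    rw [hup P]; exact hl.2.2.2.2 hyzw.2.1
  · show (w.up P).rBasicStep
    rw [hup P]; exact hl.1.2 (hyzw.2.2 P)

end Record12


/-! ## §3. `IsRecordOfRecord₁₂CB10YZWB8` — plus the [B8] pin, `b8` in its surviving form; SAME-DATUM companion in `₁₂CB10YZW` -/

section Record12B8

variable (F : T4Family) (N : ℕ) [NeZero N]

/-- **«(D, w) is the record, Stage 12, all FIVE typed carrier groups pinned, `b8` surviving»**: `IsRecordOfRecord₁₂CB10YZW` VERBATIM except that the upstream block is THE
S-BINDING `upOfRecord₅CS` at the five-pin view, for SOME residual [B8] layer `lam`. [cite: Balaban1985RegularSpaces, Lemma 1 – Thm 8 pp.79–101; Balaban1989LargeFieldII, Thm 1 + (0.1) pp.355–356 (objects of record)] -/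
def IsRecordOfRecord₁₂CB10YZWB8 (D : FiniteEpsData F (SU N)) (w : WorldP) : Prop :=
  ∃ (θ : Stage12Params F N) (h : θ.Provisos₁₂ F N) (lam : ResidB8 θ.toStage3Params) (Mstar : ℕ) (ops : OpsY N θ.toStage3Params Mstar) (ζ : ResidZ F N)
    (lamW : ResidW F N),
    θ.Admissible F N ∧ D = datumOfRecord₁₂ F N θ h ∧ w.C = D.C ∧ (0 < w.γ ∧ w.γ ≤ θ.γ) ∧ w.L = (θ.L : ℝ) ∧
      ∀ P : B12.RunParams, w.up P = upOfRecord₅CS F N (θ.view₁₂B8B10YZW F N lam Mstar ops ζ lamW) P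

/-- Inhabitation is Stage 12's exactly (all five residual types inhabited). [cite: Balaban1989LargeFieldII, Thm 1 + (0.1) pp.355–356 (bookkeeping)] -/
theorem exists_world_isRecordOfRecord₁₂CB10YZWB8 (θ : Stage12Params F N) (h : θ.Provisos₁₂ F N) (hθ : θ.Admissible F N) (lam : ResidB8 θ.toStage3Params) (Mstar : ℕ)
    (ops : OpsY N θ.toStage3Params Mstar) (ζ : ResidZ F N) (lamW : ResidW F N) {γw : ℝ} (hγw : 0 < γw ∧ γw ≤ θ.γ) :
    ∃ w : WorldP, IsRecordOfRecord₁₂CB10YZWB8 F N (datumOfRecord₁₂ F N θ h) w ∧ w.γ = γw := by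
  obtain ⟨w₀, -, -⟩ := exists_world_isRecordOfRecord₁₂C F N θ h hθ hγw
  exact ⟨{ w₀ with
      C := (datumOfRecord₁₂ F N θ h).C, γ := γw, L := (θ.L : ℝ), one_lt_L := by exact_mod_cast θ.hL.2,
      up := fun P => upOfRecord₅CS F N (θ.view₁₂B8B10YZW F N lam Mstar ops ζ lamW) P },
    ⟨θ, h, lam, Mstar, ops, ζ, lamW, hθ, rfl, rfl, hγw, rfl, fun _ => rfl⟩, rfl⟩

variable {F N}
variable {D : FiniteEpsData F (SU N)} {w : WorldP}

/-- **THE SAME-DATUM COMPANION IN `IsRecordOfRecord₁₂CB10YZW`** (witness `θ.pinB8 lam` under the C-binding): same `D`, `C`, window, `L`; leaves agree off `b8`; companion's `b8`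
(typed) ⇒ record's `b8` (surviving) — never conversely. [cite: Balaban1985RegularSpaces, Thm 8 p.101 (surviving vs typed); Balaban1989LargeFieldII, Thm 1 + (0.1) pp.355–356 (bookkeeping)] -/
theorem companion_of_isRecordOfRecord₁₂CB10YZWB8 (h : IsRecordOfRecord₁₂CB10YZWB8 F N D w) :
    ∃ w' : WorldP, IsRecordOfRecord₁₂CB10YZW F N D w' ∧ w'.C = w.C ∧ w'.γ = w.γ ∧ w'.L = w.L ∧
      (∀ P : B12.RunParams, leavesP w P = { leavesP w' P with b8 := (leavesP w P).b8 }) ∧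
      ∀ P : B12.RunParams, (leavesP w' P).b8 → (leavesP w P).b8 := by
  obtain ⟨θ, hP, lam, Mstar, ops, ζ, lamW, hθ, hD, hC, hγ, hL, hup⟩ := h
  have hup' : ∀ P, w.up P = (upOfRecord₅C F N (θ.view₁₂B8B10YZW F N lam Mstar ops ζ lamW) P).withB8 (leavesP w P).b8 := fun P => by
    show w.up P = (upOfRecord₅C F N _ P).withB8 (w.up P).b8
    rw [hup P]
    rfl
  refine ⟨{ w with up := fun P => upOfRecord₅C F N (θ.view₁₂B8B10YZW F N lam Mstar ops ζ lamW) P },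
    ⟨θ.pinB8 F N lam, hP.pinB8 lam, Mstar, ops, ζ, lamW, (Stage12Params.pinB8_admissible_iff F N _ _).2 hθ, ?_, hC, hγ, hL, fun P => rfl⟩, rfl, rfl, rfl,
      leavesP_eq_of_up_withB8 hup', fun P h8 => ?_⟩
  · rw [datumOfRecord₁₂_pinB8]; exact hD
  · have h8' := (upOfRecord₅C_view₁₂B8B10YZW_b8_iff F N θ lam Mstar ops ζ lamW P).1 h8
    show (w.up P).b8
    rw [hup P]
    exact (upOfRecord₅CS_view₁₂B8B10YZW_leaves F N θ lam Mstar ops ζ lamW P).1.2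
      (B8LeafKnitRS.b8LeafRS_of_b8LeafR (C136_C162_famB8OfRecord lam.β lam.len) h8')

/-- **THE FIVE PINNED LEAVES AT A RECORD OF THIS MODULE, for ONE parameter package**. [cite: Balaban1985RegularSpaces, Lemma 1 – Thm 8 pp.79–101; Balaban1989LargeFieldI, Prop. 1 p.194; Balaban1985BackgroundPropagators, Thm 3.1 p.397; Balaban1985UV3, Thm 1 p.257; Balaban1985Variational, Thm 1 p.279] -/
theorem leaves_iff_of_isRecordOfRecord₁₂CB10YZWB8 (h : IsRecordOfRecord₁₂CB10YZWB8 F N D w) :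
    ∃ (θ : Stage12Params F N) (lam : ResidB8 θ.toStage3Params) (Mstar : ℕ) (ops : OpsY N θ.toStage3Params Mstar) (ζ : ResidZ F N) (lamW : ResidW F N),
      θ.Admissible F N ∧ w.L = (θ.L : ℝ) ∧ ∀ P : B12.RunParams,
        ((leavesP w P).b8 ↔ B8LeafOfRecord θ.toStage3Params lam) ∧ ((leavesP w P).rBasicStep ↔ B15Leaf (WOfRecord₁₂ F N θ lamW P)) ∧
        ((leavesP w P).b9 ↔ B9LeafX (Y9OfRecord N θ.toStage3Params Mstar ops)) ∧ ((leavesP w P).b10 ↔ PrintedUV3V N θ.L) ∧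
        ((leavesP w P).b11 ↔ B11Leaf (Z11OfRecord F N ζ)) := by
  obtain ⟨θ, -, lam, Mstar, ops, ζ, lamW, hθ, -, -, -, hL, hup⟩ := h
  refine ⟨θ, lam, Mstar, ops, ζ, lamW, hθ, hL, fun P => ?_⟩
  have hl := upOfRecord₅CS_view₁₂B8B10YZW_leaves F N θ lam Mstar ops ζ lamW P
  refine ⟨?_, ?_, ?_, ?_, ?_⟩
  · show (w.up P).b8 ↔ _
    rw [hup P]; exact hl.1
  · show (w.up P).rBasicStep ↔ _
    rw [hup P]; exact hl.2.1
  · show (w.up P).b9 ↔ _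
    rw [hup P]; exact hl.2.2.1
  · show (w.up P).b10 ↔ _
    rw [hup P]; exact hl.2.2.2.1
  · show (w.up P).b11 ↔ _
    rw [hup P]; exact hl.2.2.2.2

/-- The in-edges `b4 b5 b6 b7` are THEOREMS at a record of this module (via the companion, b8-free). [cite: Balaban1983RegularityDecay, Thm p.573; Balaban1984PropagatorsI, Props. 1.1–1.2 pp.33–36; Balaban1984PropagatorsII, pp.223–250; Balaban1985Averaging, Props. 1–10 pp.26–50 (bookkeeping)] -/
theorem b4_b5_b6_b7_of_isRecordOfRecord₁₂CB10YZWB8 (h : IsRecordOfRecord₁₂CB10YZWB8 F N D w) (P : B12.RunParams) :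
    (leavesP w P).b4 ∧ (leavesP w P).b5 ∧ (leavesP w P).b6 ∧ (leavesP w P).b7 := by
  obtain ⟨w', hw', -, -, -, hleaves, -⟩ := companion_of_isRecordOfRecord₁₂CB10YZWB8 h
  have h' : (leavesP w' P).b4 ∧ (leavesP w' P).b5 ∧ (leavesP w' P).b6 ∧ (leavesP w' P).b7 :=
    atWorld_of_isRecordOfRecord₁₂CB10YZW (X := fun ℓ => ℓ.b4 ∧ ℓ.b5 ∧ ℓ.b6 ∧ ℓ.b7)
      (fun _ _ h5 P =>
        have h4 := b4_main_of_isRecordOfRecord₅C h5 P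
        have hb5 := b5_main_of_isRecordOfRecord₅C h5 P h4
        ⟨h4, hb5, N03_at_record₅C h5 P h4 hb5, b7_main_of_isRecordOfRecord₅C h5 P hb5⟩) hw' P
  rw [hleaves P]
  exact h'

/-- **N05 ∕ N07 ∕ N08 AT A RECORD OF THIS MODULE**: N05 IS «b9 → leaf», N07 IS «leaf → b9 → b11», N08 IS «leaf → b9 → b11 → b10». [cite: Balaban1985RegularSpaces, Thm 2 p.83, Thm 8 p.101; Balaban1985Variational, Thm 1 p.279; Balaban1985UV3, Thm 1 p.257 (bookkeeping)] -/
theorem b8_b11_b10_main_iff_of_isRecordOfRecord₁₂CB10YZWB8 (h : IsRecordOfRecord₁₂CB10YZWB8 F N D w) (P : B12.RunParams) :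
    (Dag.B8_main (leavesP w P) ↔ ((leavesP w P).b9 → (leavesP w P).b8)) ∧
    (Dag.B11_main (leavesP w P) ↔ ((leavesP w P).b8 → (leavesP w P).b9 → (leavesP w P).b11)) ∧
    (Dag.B10_main (leavesP w P) ↔ ((leavesP w P).b8 → (leavesP w P).b9 → (leavesP w P).b11 → (leavesP w P).b10)) := by
  obtain ⟨-, h5, h6, h7⟩ := b4_b5_b6_b7_of_isRecordOfRecord₁₂CB10YZWB8 h P
  exact ⟨⟨fun hN h9 => hN h5 h6 h7 h9, fun hN _ _ _ => hN⟩, ⟨fun hN h8 h9 => hN h5 h6 h7 h8 h9, fun hN _ _ _ => hN⟩,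
    ⟨fun hN h8 h9 h11 => hN h5 h6 h7 h8 h9 h11, fun hN _ _ _ => hN⟩⟩

/-- **N05 ∕ N07 ∕ N08 AT THE BUNDLES OF RECORD, for ONE parameter package** (the form consumers port their closers through — ref-C's (B8-2)).
[cite: Balaban1985RegularSpaces, Thm 2 p.83, Thm 8 p.101; Balaban1985Variational, Thm 1 p.279; Balaban1985UV3, Thm 1 p.257 + Thm 2 p.272 (the nodes at the objects of record)] -/
theorem nodes_iff_bundles_of_isRecordOfRecord₁₂CB10YZWB8 (h : IsRecordOfRecord₁₂CB10YZWB8 F N D w) :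
    ∃ (θ : Stage12Params F N) (lam : ResidB8 θ.toStage3Params) (Mstar : ℕ) (ops : OpsY N θ.toStage3Params Mstar) (ζ : ResidZ F N), θ.Admissible F N ∧ w.L = (θ.L : ℝ) ∧
      ∀ P : B12.RunParams,
        (Dag.B8_main (leavesP w P) ↔ (B9LeafX (Y9OfRecord N θ.toStage3Params Mstar ops) → B8LeafOfRecord θ.toStage3Params lam)) ∧
        (Dag.B11_main (leavesP w P) ↔
          (B8LeafOfRecord θ.toStage3Params lam → B9LeafX (Y9OfRecord N θ.toStage3Params Mstar ops) → B11Leaf (Z11OfRecord F N ζ))) ∧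
        (Dag.B10_main (leavesP w P) ↔
          (B8LeafOfRecord θ.toStage3Params lam → B9LeafX (Y9OfRecord N θ.toStage3Params Mstar ops) → B11Leaf (Z11OfRecord F N ζ) → PrintedUV3V N θ.L)) := by
  obtain ⟨θ, lam, Mstar, ops, ζ, lamW, hθ, hL, hl⟩ := leaves_iff_of_isRecordOfRecord₁₂CB10YZWB8 h
  refine ⟨θ, lam, Mstar, ops, ζ, hθ, hL, fun P => ?_⟩
  obtain ⟨h8, h11, h10⟩ := b8_b11_b10_main_iff_of_isRecordOfRecord₁₂CB10YZWB8 h P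
  rw [h8, h11, h10, (hl P).1, (hl P).2.2.1, (hl P).2.2.2.1, (hl P).2.2.2.2]
  exact ⟨Iff.rfl, Iff.rfl, Iff.rfl⟩

/-- **N05 «SLOTS» FORM at a record of this module** (a closer supplies `CarriersB8.b8LeafOfRecord_of_knit`). [cite: Balaban1985RegularSpaces, Lemma 1 – Thm 8 pp.79–101 (the node's shape, bookkeeping)] -/
theorem b8_main_of_isRecordOfRecord₁₂CB10YZWB8_of_slots (h : IsRecordOfRecord₁₂CB10YZWB8 F N D w)
    (hB : ∀ (θ : Stage12Params F N) (hP : θ.Provisos₁₂ F N) (lam : ResidB8 θ.toStage3Params) (Mstar : ℕ) (ops : OpsY N θ.toStage3Params Mstar) (ζ : ResidZ F N)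
      (lamW : ResidW F N), θ.Admissible F N → D = datumOfRecord₁₂ F N θ hP →
        (∀ P, w.up P = upOfRecord₅CS F N (θ.view₁₂B8B10YZW F N lam Mstar ops ζ lamW) P) → B8LeafOfRecord θ.toStage3Params lam)
    (P : B12.RunParams) : Dag.B8_main (leavesP w P) := by
  obtain ⟨θ, hP, lam, Mstar, ops, ζ, lamW, hθ, hD, -, -, -, hup⟩ := h
  intro _ _ _ _
  show (w.up P).b8
  rw [hup P]
  exact (upOfRecord₅CS_view₁₂B8B10YZW_leaves F N θ lam Mstar ops ζ lamW P).1.2 (hB θ hP lam Mstar ops ζ lamW hθ hD hup)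

/-- RE-BINDING a `₁₂C` record's world by the S-binding at the five-pin view gives a record of this module with the SAME datum. [cite: Balaban1989LargeFieldII, Thm 1 p.355 (bookkeeping)] -/
theorem isRecordOfRecord₁₂CB10YZWB8_rebind_of_isRecordOfRecord₁₂C (h : IsRecordOfRecord₁₂C F N D w) :
    ∃ (θ : Stage12Params F N) (_ : θ.Provisos₁₂ F N), θ.Admissible F N ∧ (∀ P, w.up P = upOfRecord₅C F N (θ.toStage5₁₂ F N) P) ∧
      ∀ (lam : ResidB8 θ.toStage3Params) (Mstar : ℕ) (ops : OpsY N θ.toStage3Params Mstar) (ζ : ResidZ F N) (lamW : ResidW F N),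
        IsRecordOfRecord₁₂CB10YZWB8 F N D { w with up := fun P => upOfRecord₅CS F N (θ.view₁₂B8B10YZW F N lam Mstar ops ζ lamW) P } := by
  obtain ⟨θ, hP, hθ, hD, hC, hγ, hL, hup⟩ := h
  exact ⟨θ, hP, hθ, hup, fun lam Mstar ops ζ lamW => ⟨θ, hP, lam, Mstar, ops, ζ, lamW, hθ, hD, hC, hγ, hL, fun _ => rfl⟩⟩

end Record12B8

end Literature.MathematicalPhysics.QuantumFieldTheory.Balaban1983to89.Node00

end
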